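import Literature.NumberTheory.Sieve.PolymathGEHInnerSum
import Literature.NumberTheory.Sieve.PolymathGEHTupleLevel
import Literature.NumberTheory.Sieve.PolymathGEHLevelReduce
import Literature.NumberTheory.Sieve.PolymathGEHRoughMain
import Literature.NumberTheory.Sieve.PolymathGEHSmallPrime
import Mathlib.Analysis.SpecialFunctions.SmoothTransition
import HarnessLib

/-!
# Theorem 3.6(ii) from GEH: the non-prime asymptotic (§4.5)

Trunk AntSieve, tooling toward the named fact `Literature.NumberTheory.Sieve.weakDHL_three_two_of_GEH`
(D. H. J. Polymath, Res. Math. Sci. 1:12 (2014) = arXiv:1407.4897, Theorem 3.2(xii)), here the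
assembly of Theorem 3.6(ii) (p. 10: "Assume that `GEH[ϑ]` holds for some `0 < ϑ < 1` … If
`Σ_{i≠i₀} (S(F_i) + S(G_i)) < ϑ` then we have the asymptotic (lflg)") from §4.5, pp. 16–18:
the truncation `S = S_ε + T_ε` at the primes `≤ x^ε` dividing `n + h_{i₀}`, Proposition 4.2 for `T_ε`
(`PolymathGEHSmallPrime`), the engine of §4.5 (`innerSum_divisorSumWeights_asymptotic`) for `S_ε`
with the level of distribution of the truncated sequence from `GEH` (`PolymathGEHTupleLevel`,
`PolymathGEHLevelReduce`) and its main term (cpeps) (`PolymathGEHRoughMain`), and the limit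
`ε → 0` by the depolarisation identity (`PolymathGEHDepol.tendsto_cdeps`).

* `Nonprime.reparam` — a smooth compactly supported modification of a cutoff agreeing with it on
  `[0, ∞)` (so with the same divisor sums), to which the level/main-term machinery applies;
* `nonprime_asymptotic_of_GEH` — **Theorem 3.6(ii)** in the shape consumed by
  `weakDHL_three_two_of_primesLevel_of_nonprimeAsymptotic`.

## References

* [Polymath8b2014] D. H. J. Polymath, Res. Math. Sci. 1 (2014), Art. 12 = arXiv:1407.4897,
  Theorem 3.6(ii) and §4.5, pp. 16–18.
-/

noncomputable section

open MeasureTheory Finset Real Filter Asymptotics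
open scoped Topology ArithmeticFunction.omega

namespace Literature.NumberTheory.Sieve

open scoped Classical
open Depol RoughMain SmallPrime

namespace Nonprime

open scoped ContDiff

/-! ### The smooth compactly supported modification of a cutoff -/

section Reparam

/-- `χ(t) = smoothTransition(t + 1)`: smooth, `= 1` on `[0, ∞)`, `= 0` on `(-∞, -1]`. [folklore] -/
def cutChi (t : ℝ) : ℝ := Real.smoothTransition (t + 1)

/-- `χ = 1` on `[0, ∞)`. [folklore] -/
theorem cutChi_eq_one {t : ℝ} (ht : 0 ≤ t) : cutChi t = 1 := Real.smoothTransition.one_of_one_le (by linarith)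

/-- `χ = 0` on `(-∞, -1]`. [folklore] -/
theorem cutChi_eq_zero {t : ℝ} (ht : t ≤ -1) : cutChi t = 0 := Real.smoothTransition.zero_of_nonpos (by linarith)

/-- `χ` is smooth. [folklore] -/
theorem contDiff_cutChi {n : ℕ∞} : ContDiff ℝ n cutChi :=
  Real.smoothTransition.contDiff.comp (contDiff_id.add contDiff_const)

/-- `|χ| ≤ 1`. [folklore] -/
theorem abs_cutChi_le (t : ℝ) : |cutChi t| ≤ 1 := by
  unfold cutChi
  rw [abs_of_nonneg (Real.smoothTransition.nonneg _)]; exact Real.smoothTransition.le_one _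

/-- The modification `F̃ = F · χ`. [folklore] -/
def reparam (F : ℝ → ℝ) : ℝ → ℝ := fun t => F t * cutChi t

/-- `F̃ = F` on `[0, ∞)`. [folklore] -/
theorem reparam_eq {F : ℝ → ℝ} {t : ℝ} (ht : 0 ≤ t) : reparam F t = F t := by
  rw [reparam, cutChi_eq_one ht, mul_one]

/-- `F̃ = F` on `[0, ∞)` (as `EqOn`). [folklore] -/
theorem reparam_eqOn (F : ℝ → ℝ) : Set.EqOn (reparam F) F (Set.Ici 0) := fun _ ht => reparam_eq ht

/-- `F̃` is smooth. [folklore] -/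
theorem contDiff_reparam {F : ℝ → ℝ} {s : ℝ} (hF : IsSieveCutoff F s) {n : ℕ∞} : ContDiff ℝ n (reparam F) :=
  (hF.contDiff.of_le (by exact_mod_cast le_top)).mul contDiff_cutChi

/-- `F̃` is supported in `[-1, s]`. [folklore] -/
theorem reparam_eq_zero {F : ℝ → ℝ} {s : ℝ} (hF : IsSieveCutoff F s) {t : ℝ} (ht : t ∉ Set.Icc (-1) s) : reparam F t = 0 := by
  rw [Set.mem_Icc, not_and_or, not_le, not_le] at ht
  rcases ht with ht | ht
  · rw [reparam, cutChi_eq_zero ht.le, mul_zero]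
  · rw [reparam, hF.eq_zero t ht, zero_mul]

/-- `F̃` has compact support. [folklore] -/
theorem hasCompactSupport_reparam {F : ℝ → ℝ} {s : ℝ} (hF : IsSieveCutoff F s) : HasCompactSupport (reparam F) := by
  refine HasCompactSupport.of_support_subset_isCompact (isCompact_Icc (a := (-1 : ℝ)) (b := s)) fun t ht => ?_
  by_contra h
  exact ht (reparam_eq_zero hF h)

/-- `F̃` is again a sieve cutoff with the same support bound. [folklore] -/
theorem isSieveCutoff_reparam {F : ℝ → ℝ} {s : ℝ} (hF : IsSieveCutoff F s) : IsSieveCutoff (reparam F) s :=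
  ⟨contDiff_reparam hF, hF.nonneg, fun t ht => by rw [reparam, hF.eq_zero t ht, zero_mul]⟩

/-- Iterated derivatives of a smooth compactly supported function are smooth, compactly supported
and bounded. [folklore] -/
theorem iterate_deriv_facts {f : ℝ → ℝ} (hf : ContDiff ℝ ∞ f) (hs : HasCompactSupport f) :
    ∀ n : ℕ, ContDiff ℝ ∞ (deriv^[n] f) ∧ HasCompactSupport (deriv^[n] f) ∧ ∃ C, ∀ t, |(deriv^[n] f) t| ≤ C
  | 0 => by
    refine ⟨hf, hs, ?_⟩
    obtain ⟨C, hC⟩ := hs.exists_bound_of_continuous hf.continuous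
    exact ⟨C, fun t => by have := hC t; rwa [Real.norm_eq_abs] at this⟩
  | n + 1 => by
    obtain ⟨h1, h2, -⟩ := iterate_deriv_facts hf hs n
    have h1' : ContDiff ℝ ∞ (deriv^[n + 1] f) := by
      rw [Function.iterate_succ_apply']; exact (contDiff_infty_iff_deriv.1 h1).2
    have h2' : HasCompactSupport (deriv^[n + 1] f) := by
      rw [Function.iterate_succ_apply']; exact h2.deriv
    refine ⟨h1', h2', ?_⟩
    obtain ⟨C, hC⟩ := h2'.exists_bound_of_continuous h1'.continuous
    exact ⟨C, fun t => by have := hC t; rwa [Real.norm_eq_abs] at this⟩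

/-- `F̃` is nice (bounded first and second derivatives), so is `F̃'`, and `F̃`, `F̃'` are bounded. [folklore] -/
theorem niceFun_reparam {F : ℝ → ℝ} {s : ℝ} (hF : IsSieveCutoff F s) :
    ∃ D D' M : ℝ, NiceFun (reparam F) D ∧ NiceFun (deriv (reparam F)) D' ∧ (∀ t, |reparam F t| ≤ M) ∧
      (∀ t, |deriv (reparam F) t| ≤ D) := by
  have hsm : ContDiff ℝ ∞ (reparam F) := contDiff_reparam hF
  have hcs := hasCompactSupport_reparam hF
  obtain ⟨-, -, C0, h0⟩ := iterate_deriv_facts hsm hcs 0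
  obtain ⟨hd1, -, C1, h1⟩ := iterate_deriv_facts hsm hcs 1
  obtain ⟨-, -, C2, h2⟩ := iterate_deriv_facts hsm hcs 2
  obtain ⟨-, -, C3, h3⟩ := iterate_deriv_facts hsm hcs 3
  simp only [Function.iterate_zero, id] at h0
  simp only [Function.iterate_one] at h1 hd1
  simp only [Function.iterate_succ, Function.iterate_zero, Function.comp_apply, id] at h2 h3
  refine ⟨max C1 C2, max C2 C3, C0, ⟨hsm.of_le (by exact_mod_cast ENat.natCast_le_of_coe_top_le_withTop le_rfl 2), fun t => (h1 t).trans (le_max_left _ _),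
    fun t => (h2 t).trans (le_max_right _ _)⟩, ⟨hd1.of_le (by exact_mod_cast ENat.natCast_le_of_coe_top_le_withTop le_rfl 2), fun t => (h2 t).trans (le_max_left _ _),
    fun t => (h3 t).trans (le_max_right _ _)⟩, h0, fun t => (h1 t).trans (le_max_left _ _)⟩

/-- The divisor sums of `F̃` and `F` agree (`x ≥ 0`): only values on `[0, ∞)` enter. [folklore] -/
theorem divisorSumWeight_reparam (F : ℝ → ℝ) {x : ℝ} (hx : 1 ≤ x) (n : ℕ) :
    divisorSumWeight (reparam F) x n = divisorSumWeight F x n := by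
  unfold divisorSumWeight
  refine Finset.sum_congr rfl fun d hd => ?_
  rw [reparam_eq (div_nonneg (Real.log_nonneg (by exact_mod_cast Nat.pos_of_mem_divisors hd)) (Real.log_nonneg hx))]

/-- `F̃' = F'` on `(0, ∞)`. [folklore] -/
theorem deriv_reparam_eq {F : ℝ → ℝ} {t : ℝ} (ht : 0 < t) : deriv (reparam F) t = deriv F t := by
  refine Filter.EventuallyEq.deriv_eq ?_
  filter_upwards [Ioi_mem_nhds ht] with u hu
  exact reparam_eq (le_of_lt hu)

/-- `∫₀¹ F̃' G̃' = ∫₀¹ F' G'`. [folklore] -/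
theorem integral_deriv_reparam (F G : ℝ → ℝ) :
    ∫ t in (0 : ℝ)..1, deriv (reparam F) t * deriv (reparam G) t = ∫ t in (0 : ℝ)..1, deriv F t * deriv G t := by
  refine intervalIntegral.integral_congr_ae ?_
  rw [Set.uIoc_of_le zero_le_one]
  refine Eventually.of_forall fun t ht => ?_
  rw [deriv_reparam_eq ht.1, deriv_reparam_eq ht.1]

end Reparam

/-! ### The truncated sequence, capped at `X₂` -/

section Trunc

/-- Discrepancies only see the values on `[1, N]`. [folklore] -/
theorem apDiscrepancy_congr {γ γ' : ℕ → ℝ} {N : ℕ} (h : ∀ n ∈ Finset.Icc 1 N, γ n = γ' n) (q : ℕ) (a : ZMod q) :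
    apDiscrepancy γ N q a = apDiscrepancy γ' N q a := by
  unfold apDiscrepancy
  rw [Finset.sum_congr rfl fun n hn => h n (Finset.mem_filter.1 hn).1,
    Finset.sum_congr rfl fun n hn => h n (Finset.mem_filter.1 hn).1]

/-- `w_ε` capped at `X₂`: `w(m) = λ_F(m) λ_G(m) 1_{p(m) > x^ε} 1_{m ≤ X₂}`. [cite: Polymath8b2014, §4.5, (lltrunc)] -/
def wcap (F G : ℝ → ℝ) (ε : ℝ) (h₀ : ℤ) (x : ℝ) (m : ℕ) : ℝ :=
  if m ≤ thetaX2 h₀ x then wTrunc F G ε x m else 0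

/-- Below the cap, `w = w_ε`. [folklore] -/
theorem wcap_of_le {F G : ℝ → ℝ} {ε : ℝ} {h₀ : ℤ} {x : ℝ} {m : ℕ} (hm : m ≤ thetaX2 h₀ x) :
    wcap F G ε h₀ x m = wTrunc F G ε x m := if_pos hm

/-- The inner total of the capped sequence is that of `w_ε`. [folklore] -/
theorem innerTotal_wcap (F G : ℝ → ℝ) (ε : ℝ) (h₀ : ℤ) (x : ℝ) :
    innerTotal (wcap F G ε h₀ x) (thetaX1 h₀ x) (thetaX2 h₀ x) = innerTotal (wTrunc F G ε x) (thetaX1 h₀ x) (thetaX2 h₀ x) := by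
  unfold innerTotal
  exact Finset.sum_congr rfl fun m hm => wcap_of_le (Finset.mem_Ioc.1 hm).2

/-- `w` vanishes at `0`. [folklore] -/
theorem wTrunc_zero (F G : ℝ → ℝ) (ε x : ℝ) : wTrunc F G ε x 0 = 0 := by
  simp [wTrunc, divisorSumWeight]

/-- The capped sequence is supported on `x^ε`-rough numbers. [folklore] -/
theorem wcap_rough {F G : ℝ → ℝ} {ε : ℝ} {h₀ : ℤ} {x : ℝ} {m : ℕ} (hm : wcap F G ε h₀ x m ≠ 0)
    {p : ℕ} (hp : p.Prime) (hpm : p ∣ m) : x ^ ε < p := by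
  unfold wcap at hm
  split_ifs at hm with h
  · have hm0 : m ≠ 0 := by rintro rfl; exact hm (wTrunc_zero F G ε x)
    unfold wTrunc roughInd at hm
    split_ifs at hm with hr
    · exact hr p ((Nat.mem_primeFactorsList hm0).2 ⟨hp, hpm⟩)
    · exact absurd (mul_zero _) hm
  · exact absurd rfl hm

/-- Uniform bound: `|w(m)| ≤ 4^{⌊1/ε⌋+1} M²` for large `x` (`|F|, |G| ≤ M`). [cite: Polymath8b2014, §4.5, p. 17] -/
theorem eventually_abs_wcap_le {F G : ℝ → ℝ} {M : ℝ} (hMF : ∀ t, |F t| ≤ M) (hMG : ∀ t, |G t| ≤ M)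
    {ε : ℝ} (hε : 0 < ε) (h₀ : ℤ) :
    ∀ᶠ x : ℝ in atTop, ∀ m, |wcap F G ε h₀ x m| ≤ 4 ^ (⌊1 / ε⌋₊ + 1) * M ^ 2 := by
  have hM0 : 0 ≤ M := (abs_nonneg _).trans (hMF 0)
  filter_upwards [eventually_ge_atTop (4 : ℝ), eventually_ge_atTop ((h₀.natAbs : ℝ) + 2),
    (tendsto_rpow_atTop hε).eventually_ge_atTop 3] with x hx4 hxh hxε m
  obtain ⟨-, -, hX₂3⟩ := thetaX_sizes h₀ hxh
  have hbound : 0 ≤ (4 : ℝ) ^ (⌊1 / ε⌋₊ + 1) * M ^ 2 := by positivity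
  unfold wcap
  split_ifs with hm
  · rcases eq_or_ne m 0 with rfl | hm0
    · rw [wTrunc_zero, abs_zero]; exact hbound
    unfold wTrunc roughInd
    split_ifs with hr
    · have hm3 : (m : ℝ) ≤ 3 * x := le_trans (by exact_mod_cast hm) hX₂3
      have hω : ω m ≤ ⌊1 / ε⌋₊ + 1 := by
        have h := (RoughTuples.card_primeFactors_le_of_rough hε hx4 hxε hm0 hm3 hr).1
        rwa [ArithmeticFunction.cardDistinctFactors_apply, ← List.card_toFinset]
      have h1 := abs_divisorSumWeight_le_two_pow hMF x hm0
      have h2 := abs_divisorSumWeight_le_two_pow hMG x hm0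
      rw [mul_one, abs_mul]
      calc |divisorSumWeight F x m| * |divisorSumWeight G x m| ≤ (2 ^ ω m * M) * (2 ^ ω m * M) :=
            mul_le_mul h1 h2 (abs_nonneg _) (by positivity)
        _ = 4 ^ ω m * M ^ 2 := by rw [show (4 : ℝ) ^ ω m = 2 ^ ω m * 2 ^ ω m by rw [← mul_pow]; norm_num]; ring
        _ ≤ 4 ^ (⌊1 / ε⌋₊ + 1) * M ^ 2 := mul_le_mul_of_nonneg_right (pow_le_pow_right₀ (by norm_num) hω) (sq_nonneg _)
    · rw [mul_zero, abs_zero]; exact hbound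
  · rw [abs_zero]; exact hbound

/-- For `n` in the summation range, `X₁ < n + h₀ ≤ X₂` and `n + h₀ ≥ 1` (`x ≥ |h₀| + 2`). [folklore] -/
theorem shift_mem_window {h₀ : ℤ} {x : ℝ} (hx : (h₀.natAbs : ℝ) + 2 ≤ x) {b : ℤ} {n : ℕ} (hn : n ∈ polymathRange x b) :
    thetaX1 h₀ x < ((n : ℤ) + h₀).toNat ∧ ((n : ℤ) + h₀).toNat ≤ thetaX2 h₀ x ∧ 1 ≤ (n : ℤ) + h₀ := by
  have hx0 : 0 ≤ x := le_trans (by positivity) hx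
  have hIcc := Finset.mem_Icc.1 (Finset.mem_filter.1 hn).1
  obtain ⟨-, -, -, -, -, -, e1, e2⟩ := thetaX_bounds h₀ hx
  have habs : ((h₀.natAbs : ℕ) : ℝ) = |(h₀ : ℝ)| := by rw [Nat.cast_natAbs, Int.cast_abs]
  have hh : -(h₀ : ℝ) ≤ h₀.natAbs := by rw [habs]; exact neg_le_abs _
  have hxn : x ≤ n := (le_of_mem_polymathRange hx0 hn).1
  have h1r : (1 : ℝ) ≤ n + h₀ := by linarith
  have h1 : 1 ≤ (n : ℤ) + h₀ := by exact_mod_cast h1r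
  refine ⟨?_, ?_, h1⟩
  · rw [← Int.ofNat_lt, e1, Int.toNat_of_nonneg (by linarith)]
    have : (⌈x⌉₊ : ℤ) ≤ n := by exact_mod_cast hIcc.1
    linarith
  · rw [← Int.ofNat_le, e2, Int.toNat_of_nonneg (by linarith)]
    have : (n : ℤ) ≤ ⌊2 * x⌋₊ := by exact_mod_cast hIcc.2
    linarith

end Trunc

/-! ### The truncated sum `S_ε` via the engine of §4.5 -/

section SEps

variable {H : Finset ℤ} {h₀ : ℤ}

/-- **`S_ε = (c''_ε ∏_{i<k} ∫ F_i'G_i' + o(1)) B^{-k} x/W`** ((seps), p. 17): the engine with the level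
of distribution of `w_ε` (from `GEH`, `PolymathGEHTupleLevel`) and its main term (cpeps)
(`PolymathGEHRoughMain`). [cite: Polymath8b2014, §4.5, (seps)–(cpeps)] -/
theorem seps_isLittleO (hGEH : ∀ ϑ : ℝ, 0 < ϑ → ϑ < 1 → GeneralizedElliottHalberstam ϑ)
    (hk1H : 1 ≤ H.card) (b : ℝ → ℤ) (hb : ∀ x, ∀ h ∈ H, Int.gcd (b x + h) (polymathW x) = 1) (hh₀ : h₀ ∈ H)
    {θ : ℝ} (hθ0 : 0 < θ) (hθ1 : θ < 1) (F G : ℤ → ℝ → ℝ) (sF sG : ℤ → ℝ)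
    (hF : ∀ h ∈ H.erase h₀, IsSieveCutoff (F h) (sF h)) (hG : ∀ h ∈ H.erase h₀, IsSieveCutoff (G h) (sG h))
    (hsum : ∑ h ∈ H.erase h₀, (sF h + sG h) < θ)
    {F₀ G₀ : ℝ → ℝ} {D E M : ℝ} (hF₀ : NiceFun F₀ D) (hG₀ : NiceFun G₀ E)
    (hMF : ∀ t, |F₀ t| ≤ M) (hMG : ∀ t, |G₀ t| ≤ M)
    {ε : ℝ} (hε : 0 < ε) (hε1 : ε ≤ 1 / 2) :
    (fun x : ℝ => ∑ n ∈ polymathRange x (b x),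
          wcap F₀ G₀ ε h₀ x (((n : ℤ) + h₀).toNat) * ∏ h ∈ H.erase h₀, (divisorSumWeight (F h) x ((n : ℤ) + h).toNat *
            divisorSumWeight (G h) x ((n : ℤ) + h).toNat)
        - (cdeps ε (⌊1 / ε⌋₊ + 1) F₀ G₀ * ∏ h ∈ H.erase h₀, ∫ t in (0 : ℝ)..1, deriv (F h) t * deriv (G h) t) *
          (x / (polymathB x ^ H.card * polymathW x)))
      =o[atTop] fun x : ℝ => x / (polymathB x ^ H.card * polymathW x) := by
  have hM0 : 0 ≤ M := (abs_nonneg _).trans (hMF 0)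
  -- the bounds used by the level machinery
  set Mx : ℝ := max M 1 with hMx
  set Dx : ℝ := max D E with hDx
  have hMF' : ∀ t, |F₀ t| ≤ Mx := fun t => (hMF t).trans (le_max_left _ _)
  have hMG' : ∀ t, |G₀ t| ≤ Mx := fun t => (hMG t).trans (le_max_left _ _)
  have hDF' : ∀ t, |deriv F₀ t| ≤ Dx := fun t => (hF₀.bound1 t).trans (le_max_left _ _)
  have hDG' : ∀ t, |deriv G₀ t| ≤ Dx := fun t => (hG₀.bound1 t).trans (le_max_right _ _)
  -- main term
  have hmain : (fun x : ℝ => innerTotal (wcap F₀ G₀ ε h₀ x) (thetaX1 h₀ x) (thetaX2 h₀ x) -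
      cdeps ε (⌊1 / ε⌋₊ + 1) F₀ G₀ * (x / Real.log x)) =o[atTop] fun x : ℝ => x / Real.log x := by
    have h := innerTotal_wTrunc_isLittleO hF₀ hG₀ hMF hMG hε hε1 h₀
    refine h.congr' (Eventually.of_forall fun x => ?_) (Eventually.of_forall fun _ => rfl)
    simp only [innerTotal_wcap]
  -- level of distribution
  set Cw : ℝ := 4 ^ (⌊1 / ε⌋₊ + 1) * M ^ 2 with hCw
  have hCw0 : 0 ≤ Cw := by positivity
  have hCwev := eventually_abs_wcap_le hMF hMG hε h₀ (F := F₀) (G := G₀)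
  have hrough : ∀ᶠ x : ℝ in atTop, ∀ m, wcap F₀ G₀ ε h₀ x m ≠ 0 → ∀ p : ℕ, p.Prime → p ∣ m → x ^ ε < p :=
    Eventually.of_forall fun x m hm p hp hpm => wcap_rough hm hp hpm
  have hΔ : ∀ A : ℝ, 0 < A → (fun x : ℝ => ∑ q ∈ Icc 1 ⌊x ^ θ⌋₊, ⨆ a : (ZMod q)ˣ,
      |apDiscrepancy (fun n => if thetaX1 h₀ x < n then wcap F₀ G₀ ε h₀ x n else 0) (thetaX2 h₀ x) q a|) =O[atTop]
      fun x : ℝ => x / Real.log x ^ A := by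
    intro A hA
    have h := isBigO_sum_iSup_apDiscrepancy_wTrunc hGEH hF₀.differentiable hG₀.differentiable hMF' hMG' hDF' hDG'
      hε hε1 h₀ hθ0 hθ1 hA
    refine h.congr' (Eventually.of_forall fun x => Finset.sum_congr rfl fun q _ => ?_) (Eventually.of_forall fun _ => rfl)
    refine iSup_congr fun a => ?_
    congr 1
    exact apDiscrepancy_congr (fun n hn => by simp only [wcap_of_le (Finset.mem_Icc.1 hn).2]) q a
  have hlev0 : ∀ A : ℝ, 0 < A → (fun x : ℝ => ∑ q ∈ Icc 1 ⌊x ^ θ⌋₊, innerErr (wcap F₀ G₀ ε h₀ x) q (thetaX1 h₀ x) (thetaX2 h₀ x))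
      =O[atTop] fun x : ℝ => x / Real.log x ^ A := fun A hA =>
    isBigO_sum_innerErr_of_apDiscrepancy hθ1.le h₀ hCw0 hCwev hε (by linarith) hrough hΔ hA
  have hlev : ∀ K : ℝ, 0 ≤ K → ∀ A : ℝ, 0 < A → (fun x : ℝ => ∑ q ∈ Icc 1 ⌊x ^ θ⌋₊,
      K ^ ω q * innerErr (wcap F₀ G₀ ε h₀ x) q (thetaX1 h₀ x) (thetaX2 h₀ x)) =O[atTop] fun x : ℝ => x / Real.log x ^ A :=
    fun K hK A hA => isBigO_sum_pow_omega_mul_innerErr hθ1.le h₀ hCw0 hCwev hlev0 hK hA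
  exact innerSum_divisorSumWeights_asymptotic H hk1H b hb h₀ hh₀ hθ0 hθ1 F G sF sG hF hG hsum
    (fun x => wcap F₀ G₀ ε h₀ x) _ hmain hlev

end SEps

/-! ### The tail `T_ε` via Proposition 4.2 -/

section TEps

variable {H : Finset ℤ} {h₀ : ℤ}

/-- The full product at `n` splits off the factor at `h₀`, which is `w(n+h₀)` plus the non-rough part.
[cite: Polymath8b2014, §4.5, p. 16] -/
theorem prod_sub_wcap_mul_eq {F G : ℤ → ℝ → ℝ} (hh₀ : h₀ ∈ H) {ε x : ℝ} (hx : 1 ≤ x) (hxh : (h₀.natAbs : ℝ) + 2 ≤ x)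
    {b : ℤ} {n : ℕ} (hn : n ∈ polymathRange x b) :
    ∏ h ∈ H, (divisorSumWeight (F h) x ((n : ℤ) + h).toNat * divisorSumWeight (G h) x ((n : ℤ) + h).toNat) -
      wcap (reparam (F h₀)) (reparam (G h₀)) ε h₀ x (((n : ℤ) + h₀).toNat) *
        ∏ h ∈ H.erase h₀, (divisorSumWeight (F h) x ((n : ℤ) + h).toNat * divisorSumWeight (G h) x ((n : ℤ) + h).toNat) =
      (if badN (x ^ ε) h₀ n then 1 else 0) *
        ∏ h ∈ H, (divisorSumWeight (F h) x ((n : ℤ) + h).toNat * divisorSumWeight (G h) x ((n : ℤ) + h).toNat) := by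
  obtain ⟨-, hle, h1⟩ := shift_mem_window hxh hn
  have hm0 : ((n : ℤ) + h₀).toNat ≠ 0 := by
    intro h; rw [Int.toNat_eq_zero] at h; linarith
  rw [← Finset.mul_prod_erase H _ hh₀, wcap_of_le hle, wTrunc, divisorSumWeight_reparam _ hx, divisorSumWeight_reparam _ hx]
  have hbad : (if badN (x ^ ε) h₀ n then (1 : ℝ) else 0) = 1 - roughInd (x ^ ε) (((n : ℤ) + h₀).toNat) := by
    have hiff := badN_iff_not_rough (z := x ^ ε) (h₀ := h₀) (n := n) hm0
    simp only [mOf] at hiff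
    unfold roughInd
    by_cases hr : ∀ p ∈ (((n : ℤ) + h₀).toNat).primeFactorsList, x ^ ε < (p : ℝ)
    · rw [if_neg (fun hb => (hiff.1 hb) hr), if_pos hr]; ring
    · rw [if_pos (hiff.2 hr), if_neg hr]; ring
  rw [hbad]; ring

/-- **`T_ε = O(ε B^{-k} x/W)`** for large `x` (Proposition 4.2 twice and Cauchy–Schwarz).
[cite: Polymath8b2014, §4.5, p. 16] -/
theorem teps_bound (hH : IsAdmissibleTuple H) (hk : 1 ≤ H.card) (b : ℝ → ℤ)
    (hb : ∀ x, ∀ h ∈ H, Int.gcd (b x + h) (polymathW x) = 1) (hh₀ : h₀ ∈ H) (F G : ℤ → ℝ → ℝ) (sF sG : ℤ → ℝ)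
    (hF : ∀ h ∈ H, IsSieveCutoff (F h) (sF h)) (hG : ∀ h ∈ H, IsSieveCutoff (G h) (sG h))
    {ε : ℝ} (hε : 0 < ε) (hε1 : ε < 1 / (40 * (H.card : ℝ))) :
    ∀ᶠ x : ℝ in atTop,
      |∑ n ∈ polymathRange x (b x), ∏ h ∈ H, (divisorSumWeight (F h) x ((n : ℤ) + h).toNat * divisorSumWeight (G h) x ((n : ℤ) + h).toNat) -
        ∑ n ∈ polymathRange x (b x), wcap (reparam (F h₀)) (reparam (G h₀)) ε h₀ x (((n : ℤ) + h₀).toNat) *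
          ∏ h ∈ H.erase h₀, (divisorSumWeight (F h) x ((n : ℤ) + h).toNat * divisorSumWeight (G h) x ((n : ℤ) + h).toNat)| ≤
      Real.sqrt (propConst H hF * propConst H hG) * ε * (x / (polymathB x ^ H.card * polymathW x)) := by
  filter_upwards [sum_sq_divisorSumWeights_smallPrime_le H hH hk b hb hh₀ F sF hF hε hε1,
    sum_sq_divisorSumWeights_smallPrime_le H hH hk b hb hh₀ G sG hG hε hε1,
    eventually_ge_atTop ((h₀.natAbs : ℝ) + 2), eventually_gt_atTop (1 : ℝ)] with x hFx hGx hxh hx1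
  set X₀ := x / (polymathB x ^ H.card * polymathW x) with hX₀
  have hX₀nn : 0 ≤ X₀ := div_nonneg (by linarith) (mul_nonneg (pow_nonneg (polymathB_pos hx1).le _) (Nat.cast_nonneg _))
  set S := polymathRange x (b x) with hS
  rw [← Finset.sum_sub_distrib, Finset.sum_congr rfl fun n hn => prod_sub_wcap_mul_eq hh₀ hx1.le hxh hn]
  simp_rw [boole_mul]
  rw [← Finset.sum_filter]
  -- Cauchy–Schwarz
  set f : ℕ → ℝ := fun n => ∏ h ∈ H, |divisorSumWeight (F h) x ((n : ℤ) + h).toNat| with hf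
  set g : ℕ → ℝ := fun n => ∏ h ∈ H, |divisorSumWeight (G h) x ((n : ℤ) + h).toNat| with hg
  have habs : |∑ n ∈ S.filter (badN (x ^ ε) h₀), ∏ h ∈ H, (divisorSumWeight (F h) x ((n : ℤ) + h).toNat *
      divisorSumWeight (G h) x ((n : ℤ) + h).toNat)| ≤ ∑ n ∈ S.filter (badN (x ^ ε) h₀), f n * g n := by
    refine (Finset.abs_sum_le_sum_abs _ _).trans (Finset.sum_le_sum fun n _ => ?_)
    rw [Finset.abs_prod, hf, hg, ← Finset.prod_mul_distrib]
    exact Finset.prod_le_prod (fun h _ => abs_nonneg _) fun h _ => by rw [abs_mul]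
  have hCS := sum_mul_sq_le_sq_mul_sq (S.filter (badN (x ^ ε) h₀)) f g
  have hf2 : ∑ n ∈ S.filter (badN (x ^ ε) h₀), f n ^ 2 = ∑ n ∈ S.filter (badN (x ^ ε) h₀), ∏ h ∈ H, divisorSumWeight (F h) x (mOf n h) ^ 2 := by
    refine Finset.sum_congr rfl fun n _ => ?_
    rw [hf, ← Finset.prod_pow]; exact Finset.prod_congr rfl fun h _ => by rw [sq_abs]; rfl
  have hg2 : ∑ n ∈ S.filter (badN (x ^ ε) h₀), g n ^ 2 = ∑ n ∈ S.filter (badN (x ^ ε) h₀), ∏ h ∈ H, divisorSumWeight (G h) x (mOf n h) ^ 2 := by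
    refine Finset.sum_congr rfl fun n _ => ?_
    rw [hg, ← Finset.prod_pow]; exact Finset.prod_congr rfl fun h _ => by rw [sq_abs]; rfl
  rw [hf2, hg2] at hCS
  have hfg0 : 0 ≤ ∑ n ∈ S.filter (badN (x ^ ε) h₀), f n * g n :=
    Finset.sum_nonneg fun n _ => mul_nonneg (Finset.prod_nonneg fun _ _ => abs_nonneg _) (Finset.prod_nonneg fun _ _ => abs_nonneg _)
  have hPF := propConst_nonneg H hF
  have hPG := propConst_nonneg H hG
  have hbound : (∑ n ∈ S.filter (badN (x ^ ε) h₀), f n * g n) ^ 2 ≤ (Real.sqrt (propConst H hF * propConst H hG) * ε * X₀) ^ 2 := by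
    refine hCS.trans ?_
    rw [mul_pow, mul_pow, Real.sq_sqrt (mul_nonneg hPF hPG)]
    calc (∑ n ∈ S.filter (badN (x ^ ε) h₀), ∏ h ∈ H, divisorSumWeight (F h) x (mOf n h) ^ 2) *
          ∑ n ∈ S.filter (badN (x ^ ε) h₀), ∏ h ∈ H, divisorSumWeight (G h) x (mOf n h) ^ 2
        ≤ (propConst H hF * ε * X₀) * (propConst H hG * ε * X₀) :=
          mul_le_mul hFx hGx (Finset.sum_nonneg fun n _ => Finset.prod_nonneg fun _ _ => sq_nonneg _) (by positivity)
      _ = propConst H hF * propConst H hG * ε ^ 2 * X₀ ^ 2 := by ring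
  have hR0 : 0 ≤ Real.sqrt (propConst H hF * propConst H hG) * ε * X₀ := by positivity
  exact habs.trans (pow_le_pow_iff_left₀ hfg0 hR0 two_ne_zero |>.1 hbound)

end TEps

/-! ### Theorem 3.6(ii) -/

section Main

/-- `⌊1/ε⌋ + 1 → ∞` as `ε → 0⁺`. [folklore] -/
theorem tendsto_floor_inv_add_one : Tendsto (fun ε : ℝ => ⌊1 / ε⌋₊ + 1) (𝓝[>] 0) atTop := by
  have h1 : Tendsto (fun ε : ℝ => ⌊1 / ε⌋₊) (𝓝[>] 0) atTop := by
    refine (tendsto_nat_floor_atTop (α := ℝ)).comp ?_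
    have h := tendsto_inv_nhdsGT_zero (𝕜 := ℝ)
    exact h.congr fun ε => (one_div ε).symm
  exact tendsto_atTop_mono (fun ε => Nat.le_succ _) h1

/-- **Polymath 8b, Theorem 3.6(ii)** (from `GEH[ϑ]` for all `ϑ < 1`): for admissible `H`
(`k = #H ≥ 1`), `b = b(x)` with `(b + h, W) = 1`, `h₀ ∈ H`, smooth compactly supported cutoffs
`F_h, G_h` with `Σ_{h ≠ h₀} (S(F_h) + S(G_h)) < θ < 1`,
`Σ_{x ≤ n ≤ 2x, n = b (W)} ∏_h λ_{F_h}(n+h) λ_{G_h}(n+h) = (∏_h ∫₀¹ F_h' G_h' + o(1)) B^{-k} x/W`.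
[cite: Polymath8b2014, Theorem 3.6(ii) (proof in §4.5)] -/
theorem nonprime_asymptotic_of_GEH (hGEH : ∀ ϑ : ℝ, 0 < ϑ → ϑ < 1 → GeneralizedElliottHalberstam ϑ)
    {θ : ℝ} (hθ0 : 0 < θ) (hθ1 : θ < 1) (H : Finset ℤ) (hH : IsAdmissibleTuple H) (hk : 1 ≤ H.card)
    (b : ℝ → ℤ) (hb : ∀ x, ∀ h ∈ H, Int.gcd (b x + h) (polymathW x) = 1)
    (h₀ : ℤ) (hh₀ : h₀ ∈ H) (F G : ℤ → ℝ → ℝ) (sF sG : ℤ → ℝ)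
    (hF : ∀ h ∈ H, IsSieveCutoff (F h) (sF h)) (hG : ∀ h ∈ H, IsSieveCutoff (G h) (sG h))
    (hsum : ∑ h ∈ H.erase h₀, (sF h + sG h) < θ) :
    (fun x : ℝ => ∑ n ∈ polymathRange x (b x),
          ∏ h ∈ H, (divisorSumWeight (F h) x ((n : ℤ) + h).toNat * divisorSumWeight (G h) x ((n : ℤ) + h).toNat)
        - (∏ h ∈ H, ∫ t in (0 : ℝ)..1, deriv (F h) t * deriv (G h) t) * (x / (polymathB x ^ H.card * polymathW x)))
      =o[atTop] fun x : ℝ => x / (polymathB x ^ H.card * polymathW x) := by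
  -- the modified cutoffs at `h₀`
  set F₀ := reparam (F h₀) with hF₀def
  set G₀ := reparam (G h₀) with hG₀def
  obtain ⟨DF, DF', MF, hnF, hnF', hbF, -⟩ := niceFun_reparam (hF h₀ hh₀)
  obtain ⟨DG, DG', MG, hnG, hnG', hbG, -⟩ := niceFun_reparam (hG h₀ hh₀)
  set M := max MF MG with hM
  have hMF : ∀ t, |F₀ t| ≤ M := fun t => (hbF t).trans (le_max_left _ _)
  have hMG : ∀ t, |G₀ t| ≤ M := fun t => (hbG t).trans (le_max_right _ _)
  -- constants
  set c₀ : ℝ := ∫ t in (0 : ℝ)..1, deriv (F h₀) t * deriv (G h₀) t with hc₀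
  set P : ℝ := ∏ h ∈ H.erase h₀, ∫ t in (0 : ℝ)..1, deriv (F h) t * deriv (G h) t with hP
  have hc : ∏ h ∈ H, ∫ t in (0 : ℝ)..1, deriv (F h) t * deriv (G h) t = c₀ * P := (Finset.mul_prod_erase H _ hh₀).symm
  have hc₀' : ∫ t in (0 : ℝ)..1, deriv F₀ t * deriv G₀ t = c₀ := integral_deriv_reparam _ _
  set CT : ℝ := Real.sqrt (propConst H hF * propConst H hG) with hCT
  have hCT0 : 0 ≤ CT := Real.sqrt_nonneg _
  -- the limit `ε → 0`
  have hlim : Tendsto (fun ε : ℝ => cdeps ε (⌊1 / ε⌋₊ + 1) F₀ G₀) (𝓝[>] 0) (𝓝 c₀) := by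
    rw [← hc₀']; exact tendsto_cdeps hnF hnF' hnG hnG' tendsto_floor_inv_add_one
  rw [Asymptotics.isLittleO_iff]
  intro δ hδ
  -- choose `ε`
  have hεmax : (0 : ℝ) < min (1 / 2) (1 / (40 * (H.card : ℝ))) := by
    have : (0 : ℝ) < H.card := by exact_mod_cast hk
    positivity
  obtain ⟨ε, ⟨hε0, hεlt⟩, hεc, hεT⟩ : ∃ ε : ℝ, (0 < ε ∧ ε < min (1 / 2) (1 / (40 * (H.card : ℝ)))) ∧
      |cdeps ε (⌊1 / ε⌋₊ + 1) F₀ G₀ - c₀| * |P| ≤ δ / 3 ∧ CT * ε ≤ δ / 3 := by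
    have h1 : ∀ᶠ ε : ℝ in 𝓝[>] 0, 0 < ε ∧ ε < min (1 / 2) (1 / (40 * (H.card : ℝ))) := by
      rw [eventually_nhdsWithin_iff]
      filter_upwards [eventually_lt_nhds hεmax] with ε hε hpos using ⟨hpos, hε⟩
    have h2 : ∀ᶠ ε : ℝ in 𝓝[>] 0, |cdeps ε (⌊1 / ε⌋₊ + 1) F₀ G₀ - c₀| * |P| ≤ δ / 3 := by
      have hd : 0 < δ / 3 / (|P| + 1) := by positivity
      filter_upwards [Metric.tendsto_nhds.1 hlim _ hd] with ε hε
      rw [Real.dist_eq] at hε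
      calc |cdeps ε (⌊1 / ε⌋₊ + 1) F₀ G₀ - c₀| * |P| ≤ δ / 3 / (|P| + 1) * (|P| + 1) :=
            mul_le_mul hε.le (by linarith) (abs_nonneg _) hd.le
        _ = δ / 3 := by field_simp
    have h3 : ∀ᶠ ε : ℝ in 𝓝[>] 0, CT * ε ≤ δ / 3 := by
      have ht : Tendsto (fun ε : ℝ => CT * ε) (𝓝[>] 0) (𝓝 (CT * 0)) :=
        (tendsto_nhdsWithin_of_tendsto_nhds (continuous_const.mul continuous_id).continuousAt)
      rw [mul_zero] at ht
      filter_upwards [(Metric.tendsto_nhds.1 ht) _ (by positivity : 0 < δ / 3)] with ε hε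
      rw [Real.dist_eq, sub_zero] at hε
      exact (le_abs_self _).trans hε.le
    exact (h1.and (h2.and h3)).exists
  have hε12 : ε ≤ 1 / 2 := (hεlt.le.trans (min_le_left _ _))
  have hε40 : ε < 1 / (40 * (H.card : ℝ)) := lt_of_lt_of_le hεlt (min_le_right _ _)
  -- the three eventual bounds
  have hS := seps_isLittleO hGEH hk b hb hh₀ hθ0 hθ1 F G sF sG (fun h hh => hF h (Finset.mem_of_mem_erase hh))
    (fun h hh => hG h (Finset.mem_of_mem_erase hh)) hsum hnF hnG hMF hMG hε0 hε12
  rw [Asymptotics.isLittleO_iff] at hS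
  have hS' := hS (show 0 < δ / 3 by positivity)
  have hT := teps_bound hH hk b hb hh₀ F G sF sG hF hG hε0 hε40
  filter_upwards [hS', hT, eventually_gt_atTop (1 : ℝ)] with x hSx hTx hx1
  set X₀ := x / (polymathB x ^ H.card * polymathW x) with hX₀
  have hX₀nn : 0 ≤ X₀ := div_nonneg (by linarith) (mul_nonneg (pow_nonneg (polymathB_pos hx1).le _) (Nat.cast_nonneg _))
  rw [Real.norm_of_nonneg hX₀nn] at hSx ⊢
  rw [Real.norm_eq_abs] at hSx ⊢
  set Sfull := ∑ n ∈ polymathRange x (b x),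
    ∏ h ∈ H, (divisorSumWeight (F h) x ((n : ℤ) + h).toNat * divisorSumWeight (G h) x ((n : ℤ) + h).toNat) with hSfull
  set Seps := ∑ n ∈ polymathRange x (b x), wcap F₀ G₀ ε h₀ x (((n : ℤ) + h₀).toNat) *
    ∏ h ∈ H.erase h₀, (divisorSumWeight (F h) x ((n : ℤ) + h).toNat * divisorSumWeight (G h) x ((n : ℤ) + h).toNat) with hSeps
  set cε := cdeps ε (⌊1 / ε⌋₊ + 1) F₀ G₀ with hcε
  have hdecomp : Sfull - c₀ * P * X₀ = (Seps - cε * P * X₀) + (cε - c₀) * P * X₀ + (Sfull - Seps) := by ring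
  rw [hc, hdecomp]
  have h2 : |(cε - c₀) * P * X₀| ≤ δ / 3 * X₀ := by
    rw [abs_mul, abs_mul, abs_of_nonneg hX₀nn]
    exact mul_le_mul_of_nonneg_right hεc hX₀nn
  have h3 : |Sfull - Seps| ≤ δ / 3 * X₀ :=
    hTx.trans (mul_le_mul_of_nonneg_right hεT hX₀nn)
  calc |Seps - cε * P * X₀ + (cε - c₀) * P * X₀ + (Sfull - Seps)|
      ≤ |Seps - cε * P * X₀| + |(cε - c₀) * P * X₀| + |Sfull - Seps| := by
        have e1 := abs_add_le (Seps - cε * P * X₀ + (cε - c₀) * P * X₀) (Sfull - Seps)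
        have e2 := abs_add_le (Seps - cε * P * X₀) ((cε - c₀) * P * X₀)
        linarith
    _ ≤ δ / 3 * X₀ + δ / 3 * X₀ + δ / 3 * X₀ := by
        refine add_le_add (add_le_add ?_ h2) h3
        have : cε * P * X₀ = (cε * P) * X₀ := by ring
        rw [this]; exact hSx
    _ = δ * X₀ := by ring

end Main

end Nonprime

end Literature.NumberTheory.Sieve
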